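import Literature.NumberTheory.DiophantineGeometry.FunctionFieldUnitEquation
import Literature.NumberTheory.DiophantineGeometry.FunctionFieldUnitEquationWronskianProofs
import Literature.NumberTheory.DiophantineGeometry.FunctionFieldDivisorsNegativeDegreeProofs
import HarnessLib

/-!
# The `n`-term `S`-unit equation over function fields: proofs (Zannier 1993, Corollary, p. 92–93)

Sibling proof file of `FunctionFieldUnitEquation.lean` (the named facts `Zannier1993_thm1`,
`Zannier1993_cor`, vendored AS PRINTED from U. Zannier, *Some remarks on the `S`-unit equation in
function fields*, Acta Arith. 64 (1993) 87–98 [Zannier1993]).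

This file formalizes the printed proof of the **Corollary** (p. 92, proof p. 93) from **Theorem 1**
(p. 88): `Zannier1993_cor_of_thm1 : Zannier1993_thm1 → Zannier1993_cor`. Zannier, p. 93:
"Apply Theorem 1 with `n − 1` in place of `n`, with `b = −uₙ` and with `aᵢ = uᵢ`, the assumptions
being clearly satisfied. We get `Σ_{v∈S} {v(uₙ) − min_{1≤i≤n−1} v(uᵢ)} ≤ C(μ,2)(#S + 2g − 2)`. On the
other hand, if `v ∉ S`, then `v(uᵢ) = 0` for `i = 1, …, n`, whence the range of summation in the left
hand side may be extended to all `v`. To get the Corollary it now suffices to use the equations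
`Σ_v v(uₙ) = 0` and `min_{1≤i≤n−1} v(uᵢ) = min_{1≤i≤n} v(uᵢ)`, the last one following from the basic
assumption `uₙ = −Σ_{i<n} uᵢ`." In the tree: `Σ_v deg v · v(uₙ) = deg (uₙ) = 0` is
`AlgFunctionField.degree_principalDivisor_eq_zero` (Stichtenoth Thm. 1.4.11); the last equation is the
ultrametric inequality for finite sums (`PlaceOver.le_ord_sum_of_forall_le_ord`, via
`Valuation.map_sum_le`); and `dim_k span{u₁,…,uₙ} = dim_k span{u₁,…,uₙ₋₁}` because `uₙ` lies in the
latter span (implicit in print: the `μ` of the Corollary is that of Theorem 1).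

The discharge `Zannier1993_cor_holds` then only needs `Zannier1993_thm1_holds` (Theorem 1, proof
pp. 89–92: Wronskians), which is NOT in this file.

## References

* U. Zannier, *Some remarks on the S-unit equation in function fields*, Acta Arith. 64 (1993),
  87–98, doi:10.4064/aa-64-1-87-98: Theorem 1 (p. 88), Corollary (p. 92, proof p. 93). [Zannier1993]
* H. Stichtenoth, *Algebraic Function Fields and Codes*, GTM 254 (2009), Thm. 1.4.11. [Stichtenoth2009]
-/

noncomputable section

open scoped Classical

namespace Literature.NumberTheory.DiophantineGeometry

open AlgFunctionField

universe u v

namespace AlgFunctionField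

variable {K : Type u} {F : Type v} [Field K] [Field F] [Algebra K F]

/-- Ultrametric inequality for finite sums in terms of the normalised valuation `ord_v`
(Stichtenoth Lemma 1.1.11, iterated): if `N ≤ ord_v (f i)` for every nonzero summand and the sum is
nonzero, then `N ≤ ord_v (∑ f i)`. (Phrased through the abstract valuation, `Valuation.map_sum_le`,
to avoid the junk value `ord_v 0 = 0` of vanishing partial sums.) [cite: Stichtenoth2009, Lemma 1.1.11] -/
theorem PlaceOver.le_ord_sum_of_forall_le_ord (v : PlaceOver K F) {ι : Type*} (s : Finset ι)
    (f : ι → F) (N : ℤ) (hf : ∀ i ∈ s, f i ≠ 0 → N ≤ v.ord (f i)) (hs : ∑ i ∈ s, f i ≠ 0) :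
    N ≤ v.ord (∑ i ∈ s, f i) := by
  rw [← v.valuation_le_zpow_iff_le_ord hs N]
  refine Valuation.map_sum_le _ fun i hi ↦ ?_
  by_cases h0 : f i = 0
  · simp [h0]
  · exact (v.valuation_le_zpow_iff_le_ord h0 N).2 (hf i hi h0)

/-- `min_i ord_v (f i) ≤ ord_v (∑ f i)` for a nonzero finite sum over a finite nonempty index type
(Stichtenoth Lemma 1.1.11, iterated; zero summands are harmless). [cite: Stichtenoth2009, Lemma 1.1.11] -/
theorem PlaceOver.iInf_ord_le_ord_sum (v : PlaceOver K F) {ι : Type*} [Fintype ι] [Nonempty ι]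
    (f : ι → F) (hs : ∑ i, f i ≠ 0) :
    ⨅ i, v.ord (f i) ≤ v.ord (∑ i, f i) :=
  v.le_ord_sum_of_forall_le_ord Finset.univ f _
    (fun i _ _ ↦ ciInf_le (Set.finite_range _).bddBelow i) hs

/-- For `x ≠ 0` in an algebraic function field of one variable and any finite set of places `S`
containing all zeros and poles of `x`: `Σ_{v ∈ S} deg v · ord_v x = deg (x) = 0`
(Stichtenoth Thm. 1.4.11, "all principal divisors have degree zero"; Zannier 1993, p. 93,
"`Σ_v v(uₙ) = 0`"). [cite: Stichtenoth2009, Thm. 1.4.11] -/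
theorem sum_degree_mul_ord_eq_zero [IsAlgFunctionField K F] {x : F} (hx : x ≠ 0)
    (S : Finset (PlaceOver K F)) (hS : ∀ v : PlaceOver K F, v ∉ S → v.ord x = 0) :
    ∑ v ∈ S, (v.degree : ℤ) * v.ord x = 0 := by
  have hdeg := degree_principalDivisor_eq_zero (K := K) hx
  rw [Divisor.degree_apply, Finsupp.sum_of_support_subset _ (s := S)] at hdeg
  · rw [← hdeg]
    refine Finset.sum_congr rfl fun v _ ↦ ?_
    rw [principalDivisor_apply_of_ne_zero hx, mul_comm]
  · intro v hv
    by_contra hvS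
    rw [Finsupp.mem_support_iff, principalDivisor_apply_of_ne_zero hx] at hv
    exact hv (hS v hvS)
  · intro v _
    exact zero_mul _

end AlgFunctionField

/-- **Zannier 1993, Corollary (p. 92) from Theorem 1 (p. 88)** — the printed proof (p. 93).
Given Theorem 1 (`Zannier1993_thm1`), for `n ≥ 2` non-zero `S`-units `u₁ + … + uₙ = 0` with no
proper nonempty vanishing subsum: apply Theorem 1 to `aᵢ = uᵢ` (`i < n`), `b = Σ_{i<n} aᵢ = −uₙ`
(no nonempty subsum of the `aᵢ` vanishes, the full one being `−uₙ ≠ 0`), obtaining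
`Σ_{v∈S} deg v (v(uₙ) − min_{i<n} v(uᵢ)) ≤ C(μ,2)(#S + 2g − 2)`; then `Σ_{v∈S} deg v · v(uₙ) = 0`
(`uₙ` an `S`-unit, principal divisors have degree `0`), `min_{i<n} v(uᵢ) = min_{i≤n} v(uᵢ)`
(`uₙ = −Σ_{i<n} uᵢ`, ultrametric inequality), the summand vanishes off `S`, so the finitely supported
sum over all places is the sum over `S`, and `span_k{u₁,…,uₙ} = span_k{u₁,…,uₙ₋₁}`.
[cite: Zannier1993, Corollary p. 92 (proof p. 93)] -/
theorem Zannier1993_cor_of_thm1 (h : Zannier1993_thm1) : Zannier1993_cor := by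
  intro k _ _ _ F _ _ _ S n u hn hu0 hS hsum hΓ
  obtain ⟨m, rfl⟩ : ∃ m, n = m + 1 := ⟨n - 1, by omega⟩
  have hm : 0 < m := by omega
  haveI : Nonempty (Fin m) := ⟨⟨0, hm⟩⟩
  -- Theorem 1 is applied to `aᵢ = uᵢ`, `i < n` (`n - 1 = m` of them), `b = Σ aᵢ = -uₙ`.
  set a : Fin m → F := fun i ↦ u i.castSucc with ha_def
  have ha0 : ∀ i, a i ≠ 0 := fun i ↦ hu0 _
  have haS : ∀ (v : PlaceOver k F) (i : Fin m), v ∉ S → v.ord (a i) = 0 := fun v i hv ↦ hS v _ hv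
  have hsum_a : ∑ i, a i = -u (Fin.last m) := by
    rw [Fin.sum_univ_castSucc] at hsum
    exact eq_neg_of_add_eq_zero_left hsum
  have hlast0 : u (Fin.last m) ≠ 0 := hu0 _
  have hsum_a0 : ∑ i, a i ≠ 0 := by
    rw [hsum_a]
    exact neg_ne_zero.2 hlast0
  -- no nonempty subsum of the `aᵢ` vanishes: such a subsum is a proper subsum of the `uᵢ`
  have hΓa : ∀ Γ : Finset (Fin m), Γ.Nonempty → ∑ i ∈ Γ, a i ≠ 0 := by
    intro Γ hΓne
    have h1 : (Γ.map Fin.castSuccEmb).Nonempty := (Finset.map_nonempty).2 hΓne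
    have h2 : Γ.map Fin.castSuccEmb ≠ Finset.univ := by
      intro hU
      have hmem : Fin.last m ∈ Γ.map Fin.castSuccEmb := hU ▸ Finset.mem_univ _
      obtain ⟨j, -, hj⟩ := Finset.mem_map.1 hmem
      exact Fin.castSucc_ne_last j hj
    have h3 := hΓ _ h1 h2
    rwa [Finset.sum_map] at h3
  -- Theorem 1
  have key := h k F S m a hm ha0 haS hΓa
  -- `min_{i<n} v(uᵢ) = min_{i≤n} v(uᵢ)` at every place
  have hmin : ∀ v : PlaceOver k F, ⨅ j, v.ord (u j) = ⨅ i, v.ord (a i) := by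
    intro v
    refine le_antisymm (le_ciInf fun i ↦ ciInf_le (Set.finite_range _).bddBelow i.castSucc)
      (le_ciInf fun j ↦ ?_)
    rcases Fin.eq_castSucc_or_eq_last j with ⟨i, rfl⟩ | rfl
    · exact ciInf_le (Set.finite_range _).bddBelow i
    · rw [← v.ord_neg, ← hsum_a]
      exact v.iInf_ord_le_ord_sum a hsum_a0
  -- `μ`: `span {u₁,…,uₙ} = span {u₁,…,uₙ₋₁}`
  have hspan : Submodule.span k (Set.range u) = Submodule.span k (Set.range a) := by
    refine le_antisymm (Submodule.span_le.2 ?_) (Submodule.span_mono ?_)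
    · rintro _ ⟨j, rfl⟩
      rcases Fin.eq_castSucc_or_eq_last j with ⟨i, rfl⟩ | rfl
      · exact Submodule.subset_span ⟨i, rfl⟩
      · rw [show u (Fin.last m) = -∑ i, a i by rw [hsum_a, neg_neg]]
        exact Submodule.neg_mem _ (Submodule.sum_mem _ fun i _ ↦ Submodule.subset_span ⟨i, rfl⟩)
    · rintro _ ⟨i, rfl⟩
      exact ⟨i.castSucc, rfl⟩
  -- the summand vanishes off `S`, so the finitely supported sum is the sum over `S`
  have hsupp : (Function.support fun v : PlaceOver k F ↦ -((v.degree : ℤ) * ⨅ j, v.ord (u j))) ⊆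
      (S : Set (PlaceOver k F)) := by
    intro v hv
    by_contra hvS
    refine hv ?_
    have h0 : (fun j ↦ v.ord (u j)) = fun _ ↦ (0 : ℤ) := funext fun j ↦ hS v j hvS
    simp only [h0, ciInf_const, mul_zero, neg_zero]
  rw [finsum_eq_sum_of_support_subset _ hsupp, hspan]
  -- `Σ_{v∈S} deg v · v(uₙ) = 0`
  have hdeg0 := sum_degree_mul_ord_eq_zero hlast0 S (fun v hv ↦ hS v _ hv)
  -- assemble
  have hrw : ∑ v ∈ S, -((v.degree : ℤ) * ⨅ j, v.ord (u j)) =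
      ∑ v ∈ S, (v.degree : ℤ) * (v.ord (∑ i, a i) - ⨅ i, v.ord (a i)) := by
    rw [← add_zero (∑ v ∈ S, -((v.degree : ℤ) * ⨅ j, v.ord (u j))), ← hdeg0,
      ← Finset.sum_add_distrib]
    refine Finset.sum_congr rfl fun v _ ↦ ?_
    rw [hmin v, hsum_a, v.ord_neg]
    ring
  rw [hrw]
  exact key

/-! ## Part 2: Theorem 1 in general (Zannier's induction, pp. 90–92) -/

namespace AlgFunctionField

variable {K : Type u} {F : Type v} [Field K] [Field F] [Algebra K F]

/-- `C(p,2) + C(q+1,2) ≤ C(p+q,2)` for `p ≥ 1` (the inequality behind (17):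
`C(μ_h,2) + C(μ_{h+1} − μ_h + 1, 2) ≤ C(μ_{h+1}, 2)`). [cite: Zannier1993, proof of Theorem 1, (17)] -/
theorem choose_two_add_choose_two_succ_le {p : ℕ} (hp : 1 ≤ p) (q : ℕ) :
    p.choose 2 + (q + 1).choose 2 ≤ (p + q).choose 2 := by
  induction q with
  | zero => simp
  | succ q ih =>
    have h1 : (q + 1 + 1).choose 2 = (q + 1) + (q + 1).choose 2 := by
      rw [Nat.choose_succ_succ', Nat.choose_one_right]
    have h2 : (p + (q + 1)).choose 2 = (p + q) + (p + q).choose 2 := by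
      rw [← add_assoc, Nat.choose_succ_succ', Nat.choose_one_right]
    rw [h1, h2]
    omega

/-- `ord_v (c • x) = ord_v x` for a non-zero constant `c` and `x ≠ 0`.
[cite: Stichtenoth2009, I.1.11 (2) and (5)] -/
theorem PlaceOver.ord_smul_of_ne_zero (v : PlaceOver K F) {c : K} (hc : c ≠ 0) {x : F}
    (hx : x ≠ 0) : v.ord (c • x) = v.ord x := by
  rw [Algebra.smul_def, v.ord_mul_eq ((map_ne_zero _).2 hc) hx, PlaceOver.ord_algebraMap_holds v hc,
    zero_add]

variable [IsAlgFunctionField K F] [IsIntegrallyClosedIn K F]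

/-- **`#S ≥ 2` as soon as two `S`-units are linearly independent over `K`** (implicit in Zannier's
proof, where `#S + 2g − 2 ≥ 0` is used in (16)–(17)): the quotient `aᵢ/a_j` is then a non-constant
`S`-unit, hence has a pole and a zero, at two distinct places of `S`.
[cite: Zannier1993, proof of Theorem 1] -/
theorem two_le_card_of_linearIndepOn (S : Finset (PlaceOver K F)) {ι : Type*} (a : ι → F)
    (hS : ∀ (v : PlaceOver K F) (i : ι), v ∉ S → v.ord (a i) = 0) {B : Finset ι}
    (hB : LinearIndepOn K a (B : Set ι)) {i j : ι} (hi : i ∈ B) (hj : j ∈ B) (hij : i ≠ j) :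
    2 ≤ S.card := by
  have hai : a i ≠ 0 := hB.ne_zero hi
  have haj : a j ≠ 0 := hB.ne_zero hj
  set y := a i / a j with hy
  have hyK : y ∉ Set.range (algebraMap K F) := by
    rintro ⟨c, hc⟩
    have hmem : a i ∈ Submodule.span K (a '' ((B : Set ι) \ {i})) := by
      have h1 : a i = c • a j := by rw [Algebra.smul_def, hc, hy, div_mul_cancel₀ _ haj]
      rw [h1]
      refine Submodule.smul_mem _ c (Submodule.subset_span ⟨j, ⟨Finset.mem_coe.2 hj, ?_⟩, rfl⟩)
      rw [Set.mem_singleton_iff]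
      exact fun h ↦ hij h.symm
    exact hB.notMem_span hi hmem
  have hy0 : y ≠ 0 := div_ne_zero hai haj
  have hyiK : y⁻¹ ∉ Set.range (algebraMap K F) := by
    rintro ⟨c, hc⟩
    exact hyK ⟨c⁻¹, by rw [map_inv₀, hc, inv_inv]⟩
  obtain ⟨P, hP⟩ := exists_placeOver_not_mem (K := K) (transcendental_of_not_mem_range hyK)
  obtain ⟨Q, hQ⟩ := exists_placeOver_not_mem (K := K) (transcendental_of_not_mem_range hyiK)
  have hPord : P.ord y < 0 := by
    rw [← not_le, ← P.mem_toValuationSubring_iff_ord_nonneg hy0]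
    exact hP
  have hQord : 0 < Q.ord y := by
    have h := hQ
    rw [Q.mem_toValuationSubring_iff_ord_nonneg (inv_ne_zero hy0), Q.ord_inv hy0, not_le] at h
    omega
  have hordy : ∀ v : PlaceOver K F, v ∉ S → v.ord y = 0 := fun v hv ↦ by
    rw [hy, v.ord_div hai haj, hS v i hv, hS v j hv, sub_zero]
  have hPS : P ∈ S := by
    by_contra h
    have := hordy P h
    omega
  have hQS : Q ∈ S := by
    by_contra h
    have := hordy Q h
    omega
  have hPQ : P ≠ Q := by
    rintro rfl
    omega
  exact Finset.one_lt_card_iff.2 ⟨P, Q, hPS, hQS, hPQ⟩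

variable [CharZero K]

/-- **Zannier 1993, Theorem 1** over an arbitrary finite index type, for a function field of
characteristic `0` with full constant field `K` and all places rational (the situation of an
algebraically closed `k`): for non-zero `S`-units `(aᵢ)_{i∈ι}` with no vanishing non-empty subsum and
`b = Σ aᵢ`: `Σ_{v∈S} (v(b) − min_i v(aᵢ)) ≤ C(μ,2)(#S + 2g − 2)`, `μ = dim_K span{aᵢ}`. Proof as printed
(pp. 89–92), by strong induction on `#ι`: the case `μ = n` (`Zannier1993_sum_le_of_linearIndependent`,
applied to the twisted basis `γᵢaᵢ`), (9)–(11) and the recursive construction (i)–(iii), (12)–(17) with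
index sets `A₀ ⊆ A ⊆ B` in place of the renumberings; see the module docstring.
[cite: Zannier1993, Theorem 1 (proof pp. 89–92)] -/
theorem Zannier1993_thm1_rat (hrat : ∀ P : PlaceOver K F, P.IsRational) (S : Finset (PlaceOver K F)) :
    ∀ (n : ℕ) {ι : Type} [Fintype ι] [DecidableEq ι], Fintype.card ι = n → ∀ (a : ι → F),
      Nonempty ι → (∀ i, a i ≠ 0) → (∀ (v : PlaceOver K F) (i : ι), v ∉ S → v.ord (a i) = 0) →
      (∀ Γ : Finset ι, Γ.Nonempty → ∑ i ∈ Γ, a i ≠ 0) →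
      ∑ v ∈ S, (v.ord (∑ i, a i) - ⨅ i, v.ord (a i)) ≤
        ((Module.finrank K (Submodule.span K (Set.range a))).choose 2 : ℤ) *
          ((S.card : ℤ) + (2 * (genus K F : ℤ) - 2)) := by
  intro n
  induction n using Nat.strong_induction_on with
  | _ n ih =>
  intro ι _ _ hcard a hne ha0 hS hsub
  haveI : Nonempty ι := hne
  set X : ℤ := (S.card : ℤ) + (2 * (genus K F : ℤ) - 2) with hX_def
  set b : F := ∑ i, a i with hb_def
  have hb0 : b ≠ 0 := hsub Finset.univ Finset.univ_nonempty
  /- (9): a basis `{aᵢ : i ∈ B}` of `Σ K aᵢ` among the `aᵢ`, with coordinates `λ` -/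
  obtain ⟨Bset, -, -, hspan, hBind⟩ :=
    exists_linearIndepOn_extension (linearIndepOn_empty K a) (Set.empty_subset (Set.univ : Set ι))
  set B : Finset ι := Bset.toFinset with hB_def
  have hBcoe : (B : Set ι) = Bset := Set.coe_toFinset Bset
  have hBind' : LinearIndepOn K a (B : Set ι) := by
    rw [hBcoe]
    exact hBind
  have hBli : LinearIndependent K (fun x : B ↦ a (x : ι)) := hBind'
  have hmemspan : ∀ j, a j ∈ Submodule.span K (a '' (B : Set ι)) := fun j ↦ by
    rw [hBcoe]
    exact hspan ⟨j, Set.mem_univ _, rfl⟩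
  have hcoord0 : ∀ c : ι → K, ∑ i ∈ B, c i • a i = 0 → ∀ i ∈ B, c i = 0 :=
    linearIndepOn_finset_iff.1 hBind'
  have hlam_ex : ∀ j, ∃ c : ι → K, ∑ i ∈ B, c i • a i = a j := fun j ↦
    (Submodule.mem_span_image_finset_iff_exists_fun' K).1 (hmemspan j)
  choose lam hlam using hlam_ex
  -- basis vectors have Kronecker coordinates
  have hlamB : ∀ i₁ ∈ B, ∀ i ∈ B, lam i₁ i = if i = i₁ then 1 else 0 := by
    intro i₁ hi₁ i hi
    have h := hcoord0 (fun k ↦ lam i₁ k - if k = i₁ then 1 else 0) ?_ i hi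
    · exact sub_eq_zero.1 h
    · simp_rw [sub_smul, Finset.sum_sub_distrib, hlam i₁, ite_smul, one_smul, zero_smul,
        Finset.sum_ite_eq', if_pos hi₁, sub_self]
  -- `μ = #B`
  have hμ : Module.finrank K (Submodule.span K (Set.range a)) = B.card := by
    have hspan_eq : Submodule.span K (Set.range a) =
        Submodule.span K (Set.range fun x : B ↦ a (x : ι)) := by
      apply le_antisymm
      · rw [Submodule.span_le]
        rintro _ ⟨j, rfl⟩
        refine (Submodule.span_mono ?_) (hmemspan j)
        rintro _ ⟨i, hi, rfl⟩
        exact ⟨⟨i, Finset.mem_coe.1 hi⟩, rfl⟩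
      · rw [Submodule.span_le]
        rintro _ ⟨x, rfl⟩
        exact Submodule.subset_span ⟨(x : ι), rfl⟩
    rw [hspan_eq, finrank_span_eq_card hBli, Fintype.card_coe]
  /- `β` = coordinates of `b`; `A₀` = their support (`ν = #A₀`) -/
  set β : ι → K := fun i ↦ ∑ j, lam j i with hβ_def
  have hβb : ∑ i ∈ B, β i • a i = b := by
    have h1 : ∑ i ∈ B, β i • a i = ∑ i ∈ B, ∑ j, lam j i • a i :=
      Finset.sum_congr rfl fun i _ ↦ Finset.sum_smul
    rw [h1, Finset.sum_comm]
    exact Finset.sum_congr rfl fun j _ ↦ hlam j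
  set A₀ : Finset ι := B.filter fun i ↦ β i ≠ 0 with hA₀_def
  have hA₀B : A₀ ⊆ B := Finset.filter_subset _ _
  have hβA₀ : ∀ i ∈ A₀, β i ≠ 0 := fun i hi ↦ (Finset.mem_filter.1 hi).2
  have hβ0 : ∀ i ∈ B, i ∉ A₀ → β i = 0 := by
    intro i hi hiA
    by_contra h
    exact hiA (Finset.mem_filter.2 ⟨hi, h⟩)
  have hβb' : ∑ i ∈ A₀, β i • a i = b := by
    rw [← hβb, hA₀_def, Finset.sum_filter]
    refine Finset.sum_congr rfl fun i _ ↦ ?_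
    by_cases h : β i ≠ 0
    · rw [if_pos h]
    · rw [if_neg h, not_not.1 h, zero_smul]
  have hA₀ne : A₀.Nonempty := by
    by_contra h
    rw [Finset.not_nonempty_iff_eq_empty] at h
    rw [h, Finset.sum_empty] at hβb'
    exact hb0 hβb'.symm
  have hBne : B.Nonempty := hA₀ne.mono hA₀B
  -- `#S + 2g − 2 ≥ 0` as soon as `#B ≥ 2`
  have hX2 : 2 ≤ B.card → 0 ≤ X := by
    intro h2
    obtain ⟨i, j, hi, hj, hij⟩ := Finset.one_lt_card_iff.1 h2
    have := two_le_card_of_linearIndepOn S a hS hBind' hi hj hij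
    have hg : (0 : ℤ) ≤ genus K F := Int.natCast_nonneg _
    rw [hX_def]
    omega
  /- the induction hypothesis for a twisted subfamily `(κᵢ aᵢ)_{i ∈ E}`, `#E < n` -/
  have hIH : ∀ (E : Finset ι) (κ : ι → K), E.Nonempty → E.card < n → (∀ i ∈ E, κ i ≠ 0) →
      (∀ Γ : Finset ι, Γ ⊆ E → Γ.Nonempty → ∑ i ∈ Γ, κ i • a i ≠ 0) → 0 ≤ X →
      ∑ v ∈ S, (v.ord (∑ i ∈ E, κ i • a i) - ⨅ x : E, v.ord (a x)) ≤ (E.card.choose 2 : ℤ) * X := by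
    intro E κ hEne hEcard hκ hEsub hX0
    set a' : E → F := fun x ↦ κ x • a x with ha'_def
    have hne' : Nonempty E := hEne.to_subtype
    have ha'0 : ∀ x, a' x ≠ 0 := fun x ↦ smul_ne_zero (hκ x x.2) (ha0 x)
    have ha'S : ∀ (v : PlaceOver K F) (x : E), v ∉ S → v.ord (a' x) = 0 := fun v x hv ↦ by
      change v.ord (κ x • a x) = 0
      rw [v.ord_smul_of_ne_zero (hκ x x.2) (ha0 x), hS v x hv]
    have ha'sub : ∀ Γ : Finset E, Γ.Nonempty → ∑ x ∈ Γ, a' x ≠ 0 := by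
      intro Γ hΓ
      have h := hEsub (Γ.map (Function.Embedding.subtype _)) ?_ ((Finset.map_nonempty).2 hΓ)
      · rwa [Finset.sum_map] at h
      · intro i hi
        rw [Finset.mem_map] at hi
        obtain ⟨x, -, rfl⟩ := hi
        exact x.2
    have hcardE : Fintype.card E = E.card := Fintype.card_coe E
    have key := ih E.card hEcard hcardE a' hne' ha'0 ha'S ha'sub
    have hsum : ∑ x, a' x = ∑ i ∈ E, κ i • a i := Finset.sum_coe_sort E (fun i ↦ κ i • a i)
    have hinf : ∀ v : PlaceOver K F, (⨅ x, v.ord (a' x)) = ⨅ x : E, v.ord (a x) := fun v ↦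
      iInf_congr fun x ↦ v.ord_smul_of_ne_zero (hκ x x.2) (ha0 x)
    simp_rw [hsum, hinf] at key
    refine key.trans (mul_le_mul_of_nonneg_right ?_ hX0)
    have hfr : Module.finrank K (Submodule.span K (Set.range a')) ≤ E.card := by
      rw [← hcardE]
      exact finrank_range_le_card a'
    exact_mod_cast Nat.choose_le_choose 2 hfr
  /- the special case `μ = n` for the twisted basis `(κᵢ aᵢ)_{i ∈ B}` -/
  have hSC : ∀ κ : ι → K, (∀ i ∈ B, κ i ≠ 0) →
      ∑ v ∈ S, (v.ord (∑ i ∈ B, κ i • a i) - ⨅ x : B, v.ord (a x)) ≤ (B.card.choose 2 : ℤ) * X := by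
    intro κ hκ
    have hm : 0 < B.card := Finset.card_pos.2 hBne
    set e := B.equivFin with he
    set f : Fin B.card → F := fun k ↦ κ (e.symm k) • a (e.symm k) with hf_def
    have hfind : LinearIndependent K f := by
      have h2 : LinearIndependent K (fun k : Fin B.card ↦ a (e.symm k : ι)) :=
        hBli.comp e.symm e.symm.injective
      have h3 := h2.units_smul fun k ↦ Units.mk0 (κ (e.symm k)) (hκ _ (e.symm k).2)
      convert h3 using 1
      funext k
      rw [Pi.smul_apply', Units.smul_mk0]
    have hfS : ∀ (v : PlaceOver K F) (k : Fin B.card), v ∉ S → v.ord (f k) = 0 := fun v k hv ↦ by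
      change v.ord (κ (e.symm k) • a (e.symm k)) = 0
      rw [v.ord_smul_of_ne_zero (hκ _ (e.symm k).2) (ha0 _), hS v _ hv]
    have key := Zannier1993_sum_le_of_linearIndependent hrat S hm f hfind hfS
    have hsum : ∑ k, f k = ∑ i ∈ B, κ i • a i := by
      rw [Equiv.sum_comp e.symm (fun x : B ↦ κ x • a x), Finset.sum_coe_sort B (fun i ↦ κ i • a i)]
    have hinf : ∀ v : PlaceOver K F, (⨅ k, v.ord (f k)) = ⨅ x : B, v.ord (a x) := by
      intro v
      have h1 : (fun k ↦ v.ord (f k)) = fun k ↦ v.ord (a (e.symm k : ι)) :=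
        funext fun k ↦ v.ord_smul_of_ne_zero (hκ _ (e.symm k).2) (ha0 _)
      rw [show (⨅ k, v.ord (f k)) = ⨅ k, v.ord (a (e.symm k : ι)) from congrArg iInf h1]
      exact Equiv.iInf_comp (g := fun x : B ↦ v.ord (a x)) e.symm
    simp_rw [hsum, hinf] at key
    rw [← hX_def] at key
    exact key
  /- (iii): the statement for index sets `A`, `A₀ ⊆ A ⊆ B` -/
  set P : Finset ι → Prop := fun A ↦
    ∑ v ∈ S, (v.ord b - ⨅ x : A, v.ord (a x)) ≤ (A.card.choose 2 : ℤ) * X with hP_def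
  -- (10): `min_{i∈B} v(aᵢ) = min_i v(aᵢ)`, so `P B` is the theorem
  suffices hPB : P B by
    have hinfB : ∀ v : PlaceOver K F, (⨅ i, v.ord (a i)) = ⨅ x : B, v.ord (a x) := by
      intro v
      haveI : Nonempty B := hBne.to_subtype
      refine le_antisymm (le_ciInf fun x ↦ ciInf_le (Set.finite_range _).bddBelow (x : ι))
        (le_ciInf fun j ↦ ?_)
      rw [← hlam j]
      refine v.le_ord_sum_of_forall_le_ord B (fun i ↦ lam j i • a i) _ (fun i hi hne0 ↦ ?_)
        (by rw [hlam j]; exact ha0 j)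
      have hl : lam j i ≠ 0 := by
        rintro h
        rw [h, zero_smul] at hne0
        exact hne0 rfl
      rw [v.ord_smul_of_ne_zero hl (ha0 i)]
      exact ciInf_le (Set.finite_range _).bddBelow (⟨i, hi⟩ : B)
    simp_rw [hinfB, hμ]
    exact hPB
  /- (11): `P A₀` -/
  have hPA₀ : P A₀ := by
    by_cases hA₀B' : A₀ = B
    · -- `ν = μ`: the special case for `b = Σ_{i∈B} βᵢ aᵢ`
      have h := hSC β (fun i hi ↦ hβA₀ i (hA₀B' ▸ hi))
      rw [hβb] at h
      change ∑ v ∈ S, (v.ord b - ⨅ x : A₀, v.ord (a x)) ≤ (A₀.card.choose 2 : ℤ) * X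
      rw [hA₀B']
      exact h
    · -- `ν < μ`: the induction hypothesis for `(βᵢ aᵢ)_{i ∈ A₀}`
      have hlt : A₀.card < B.card :=
        Finset.card_lt_card (Finset.ssubset_iff_subset_ne.2 ⟨hA₀B, hA₀B'⟩)
      have hcardlt : A₀.card < n := by
        have h2 : B.card ≤ n := hcard ▸ Finset.card_le_univ B
        omega
      have hX0 : 0 ≤ X := hX2 (by have := Finset.card_pos.2 hA₀ne; omega)
      have hsubA₀ : ∀ Γ : Finset ι, Γ ⊆ A₀ → Γ.Nonempty → ∑ i ∈ Γ, β i • a i ≠ 0 := by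
        intro Γ hΓ hΓne hzero
        obtain ⟨i₀, hi₀⟩ := hΓne
        have h := hcoord0 (fun i ↦ if i ∈ Γ then β i else 0) ?_ i₀ (hA₀B (hΓ hi₀))
        · rw [if_pos hi₀] at h
          exact hβA₀ i₀ (hΓ hi₀) h
        · simp_rw [ite_smul, zero_smul, Finset.sum_ite_mem, Finset.inter_eq_right.2 (hΓ.trans hA₀B)]
          exact hzero
      have key := hIH A₀ β hA₀ne hcardlt hβA₀ hsubA₀ hX0
      rw [hβb'] at key
      exact key
  /- the recursive step (pp. 91–92): enlarge `A ⊊ B` keeping (iii) -/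
  have hstep : ∀ A : Finset ι, A₀ ⊆ A → A ⊆ B → A ≠ B → P A →
      ∃ A' : Finset ι, A ⊂ A' ∧ A' ⊆ B ∧ P A' := by
    intro A hA₀A hAB hAneB hPA
    have hAne : A.Nonempty := hA₀ne.mono hA₀A
    -- `a_j = T_j + U_j`
    set T : ι → F := fun j ↦ ∑ i ∈ A, lam j i • a i with hT_def
    set U : ι → F := fun j ↦ ∑ i ∈ B \ A, lam j i • a i with hU_def
    have hTU : ∀ j, T j + U j = a j := fun j ↦ by
      change ∑ i ∈ A, lam j i • a i + ∑ i ∈ B \ A, lam j i • a i = a j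
      rw [add_comm, Finset.sum_sdiff hAB, hlam j]
    have hβBA : ∀ i ∈ B \ A, β i = 0 := fun i hi ↦
      hβ0 i (Finset.mem_sdiff.1 hi).1 fun h ↦ (Finset.mem_sdiff.1 hi).2 (hA₀A h)
    have hUsum : ∑ j, U j = 0 := by
      change ∑ j, ∑ i ∈ B \ A, lam j i • a i = 0
      rw [Finset.sum_comm]
      refine Finset.sum_eq_zero fun i hi ↦ ?_
      rw [← Finset.sum_smul]
      change β i • a i = 0
      rw [hβBA i hi, zero_smul]
    -- (12): some `j₀` with `T_{j₀} ≠ 0 ≠ U_{j₀}`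
    obtain ⟨j₀, hTj₀, hUj₀⟩ : ∃ j₀, T j₀ ≠ 0 ∧ U j₀ ≠ 0 := by
      by_contra hcon
      push Not at hcon
      set Γ : Finset ι := Finset.univ.filter fun j ↦ U j ≠ 0 with hΓ_def
      have hΓsum : ∑ j ∈ Γ, a j = 0 := by
        calc ∑ j ∈ Γ, a j = ∑ j ∈ Γ, U j := Finset.sum_congr rfl fun j hj ↦ by
                have hU : U j ≠ 0 := (Finset.mem_filter.1 hj).2
                have hT : T j = 0 := by
                  by_contra h
                  exact hU (hcon j h)
                rw [← hTU j, hT, zero_add]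
          _ = ∑ j, U j := Finset.sum_filter_ne_zero _
          _ = 0 := hUsum
      obtain ⟨i₁, hi₁⟩ : (B \ A).Nonempty := by
        rw [Finset.sdiff_nonempty]
        exact fun h ↦ hAneB (Finset.Subset.antisymm hAB h)
      have hi₁B : i₁ ∈ B := (Finset.mem_sdiff.1 hi₁).1
      have hUi₁ : U i₁ = a i₁ := by
        change ∑ i ∈ B \ A, lam i₁ i • a i = a i₁
        rw [Finset.sum_congr rfl fun i hi ↦ by rw [hlamB i₁ hi₁B i (Finset.mem_sdiff.1 hi).1]]
        simp_rw [ite_smul, one_smul, zero_smul]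
        rw [Finset.sum_ite_eq', if_pos hi₁]
      have hΓne : Γ.Nonempty :=
        ⟨i₁, Finset.mem_filter.2 ⟨Finset.mem_univ _, by rw [hUi₁]; exact ha0 i₁⟩⟩
      exact hsub Γ hΓne hΓsum
    -- `j₀ ∉ B`
    have hj₀B : j₀ ∉ B := by
      intro hj₀
      by_cases hj₀A : j₀ ∈ A
      · apply hUj₀
        change ∑ i ∈ B \ A, lam j₀ i • a i = 0
        refine Finset.sum_eq_zero fun i hi ↦ ?_
        rw [hlamB j₀ hj₀ i (Finset.mem_sdiff.1 hi).1, if_neg, zero_smul]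
        rintro rfl
        exact (Finset.mem_sdiff.1 hi).2 hj₀A
      · apply hTj₀
        change ∑ i ∈ A, lam j₀ i • a i = 0
        refine Finset.sum_eq_zero fun i hi ↦ ?_
        rw [hlamB j₀ hj₀ i (hAB hi), if_neg, zero_smul]
        rintro rfl
        exact hj₀A hi
    -- (13)–(14): `B' = {i ∈ B ∖ A : λ_{i,j₀} ≠ 0}`, `A' = A ∪ B'`
    set B' : Finset ι := (B \ A).filter fun i ↦ lam j₀ i ≠ 0 with hB'_def
    have hB'sub : B' ⊆ B \ A := Finset.filter_subset _ _
    have hB'B : B' ⊆ B := hB'sub.trans Finset.sdiff_subset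
    have hlamB' : ∀ i ∈ B', lam j₀ i ≠ 0 := fun i hi ↦ (Finset.mem_filter.1 hi).2
    have hUj₀' : U j₀ = ∑ i ∈ B', lam j₀ i • a i := by
      change ∑ i ∈ B \ A, lam j₀ i • a i = _
      rw [hB'_def, Finset.sum_filter]
      refine Finset.sum_congr rfl fun i _ ↦ ?_
      by_cases h : lam j₀ i ≠ 0
      · rw [if_pos h]
      · rw [if_neg h, not_not.1 h, zero_smul]
    have hB'ne : B'.Nonempty := by
      by_contra h
      rw [Finset.not_nonempty_iff_eq_empty] at h
      apply hUj₀
      rw [hUj₀', h, Finset.sum_empty]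
    have hdisj : Disjoint A B' := Finset.disjoint_of_subset_right hB'sub Finset.disjoint_sdiff
    set A' : Finset ι := A ∪ B' with hA'_def
    have hAA' : A ⊂ A' := by
      rw [Finset.ssubset_iff_subset_ne]
      refine ⟨Finset.subset_union_left, fun h ↦ ?_⟩
      obtain ⟨i, hi⟩ := hB'ne
      have hiA : i ∈ A := by
        rw [h]
        exact Finset.mem_union_right A hi
      exact Finset.disjoint_left.1 hdisj hiA hi
    have hA'B : A' ⊆ B := Finset.union_subset hAB hB'B
    have hcardA' : A'.card = A.card + B'.card := Finset.card_union_of_disjoint hdisj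
    refine ⟨A', hAA', hA'B, ?_⟩
    -- (15)–(16): the induction hypothesis for `a_{j₀}, −λ_{i,j₀} aᵢ (i ∈ B')`, whose sum is `T_{j₀}`
    have hj₀B' : j₀ ∉ B' := fun h ↦ hj₀B (hB'B h)
    set Bj : Finset ι := insert j₀ B' with hBj_def
    set κ : ι → K := fun i ↦ if i = j₀ then 1 else -lam j₀ i with hκ_def
    have hκ0 : ∀ i ∈ Bj, κ i ≠ 0 := by
      intro i hi
      change (if i = j₀ then (1 : K) else -lam j₀ i) ≠ 0
      by_cases h : i = j₀
      · rw [if_pos h]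
        exact one_ne_zero
      · rw [if_neg h, neg_ne_zero]
        exact hlamB' i (Finset.mem_of_mem_insert_of_ne hi h)
    have hκsum : ∀ Γ : Finset ι, Γ ⊆ B' → ∑ i ∈ Γ, κ i • a i = -∑ i ∈ Γ, lam j₀ i • a i := by
      intro Γ hΓ
      rw [← Finset.sum_neg_distrib]
      refine Finset.sum_congr rfl fun i hi ↦ ?_
      change (if i = j₀ then (1 : K) else -lam j₀ i) • a i = _
      rw [if_neg (show i ≠ j₀ from fun h ↦ hj₀B' (h ▸ hΓ hi)), neg_smul]
    have hκj₀ : κ j₀ = 1 := if_pos rfl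
    have hBjsum : ∑ i ∈ Bj, κ i • a i = T j₀ := by
      rw [hBj_def, Finset.sum_insert hj₀B', hκsum B' subset_rfl, ← hUj₀', hκj₀, one_smul,
        ← hTU j₀]
      ring
    have hBjcard' : Bj.card = B'.card + 1 := Finset.card_insert_of_notMem hj₀B'
    have hBjcard : Bj.card < n := by
      have h1 : A'.card ≤ B.card := Finset.card_le_card hA'B
      have h3 : 1 ≤ A.card := Finset.card_pos.2 hAne
      have h4 : B.card < n := by
        have : B.card < (Finset.univ : Finset ι).card :=
          Finset.card_lt_card (Finset.ssubset_iff_subset_ne.2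
            ⟨Finset.subset_univ B, fun h ↦ hj₀B (h ▸ Finset.mem_univ j₀)⟩)
        rwa [Finset.card_univ, hcard] at this
      omega
    have hBjne : Bj.Nonempty := Finset.insert_nonempty _ _
    have hBjsub : ∀ Γ : Finset ι, Γ ⊆ Bj → Γ.Nonempty → ∑ i ∈ Γ, κ i • a i ≠ 0 := by
      intro Γ hΓ hΓne hzero
      by_cases hjΓ : j₀ ∈ Γ
      · -- `a_{j₀} = Σ_{Γ∖{j₀}} λ_{i,j₀} aᵢ` would force `T_{j₀} = 0`
        set Γ' : Finset ι := Γ.erase j₀ with hΓ'_def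
        have hΓ'B' : Γ' ⊆ B' := fun i hi ↦
          Finset.mem_of_mem_insert_of_ne (hΓ (Finset.mem_of_mem_erase hi)) (Finset.ne_of_mem_erase hi)
        have hsplit : ∑ i ∈ Γ, κ i • a i = a j₀ - ∑ i ∈ Γ', lam j₀ i • a i := by
          rw [← Finset.insert_erase hjΓ, Finset.sum_insert (Finset.notMem_erase j₀ Γ), hκsum Γ' hΓ'B',
            hκj₀, one_smul, sub_eq_add_neg]
        rw [hsplit, sub_eq_zero] at hzero
        have hc := hcoord0 (fun i ↦ lam j₀ i - if i ∈ Γ' then lam j₀ i else 0) ?_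
        · apply hTj₀
          change ∑ i ∈ A, lam j₀ i • a i = 0
          refine Finset.sum_eq_zero fun i hi ↦ ?_
          have hiΓ' : i ∉ Γ' := fun h ↦ Finset.disjoint_left.1 hdisj hi (hΓ'B' h)
          have := hc i (hAB hi)
          rw [if_neg hiΓ', sub_zero] at this
          rw [this, zero_smul]
        · simp_rw [sub_smul, Finset.sum_sub_distrib, hlam j₀, ite_smul, zero_smul, Finset.sum_ite_mem,
            Finset.inter_eq_right.2 (hΓ'B'.trans hB'B), ← hzero, sub_self]
      · have hΓB' : Γ ⊆ B' := fun i hi ↦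
          Finset.mem_of_mem_insert_of_ne (hΓ hi) (fun h ↦ hjΓ (h ▸ hi))
        rw [hκsum Γ hΓB', neg_eq_zero] at hzero
        obtain ⟨i₀, hi₀⟩ := hΓne
        have hc := hcoord0 (fun i ↦ if i ∈ Γ then lam j₀ i else 0) ?_ i₀ (hB'B (hΓB' hi₀))
        · rw [if_pos hi₀] at hc
          exact hlamB' i₀ (hΓB' hi₀) hc
        · simp_rw [ite_smul, zero_smul, Finset.sum_ite_mem, Finset.inter_eq_right.2 (hΓB'.trans hB'B)]
          exact hzero
    have hX0 : 0 ≤ X := hX2 (by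
      have := Finset.card_lt_card hAA'
      have := Finset.card_le_card hA'B
      have := Finset.card_pos.2 hAne
      omega)
    have key := hIH Bj κ hBjne hBjcard hκ0 hBjsub hX0
    rw [hBjsum] at key
    -- (17) and the lower bound `v(T_{j₀}) ≥ max (min_A v(aᵢ), min_{Bj} v(aᵢ))`
    have hPA' : ∑ v ∈ S, (v.ord b - ⨅ x : A, v.ord (a x)) ≤ (A.card.choose 2 : ℤ) * X := hPA
    have hterm : ∀ v : PlaceOver K F,
        v.ord b - (⨅ x : A', v.ord (a x)) ≤
          (v.ord b - ⨅ x : A, v.ord (a x)) + (v.ord (T j₀) - ⨅ x : Bj, v.ord (a x)) := by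
      intro v
      haveI : Nonempty A := hAne.to_subtype
      haveI : Nonempty Bj := hBjne.to_subtype
      haveI : Nonempty A' := (hAne.mono hAA'.subset).to_subtype
      have h1 : (⨅ x : A, v.ord (a x)) ≤ v.ord (T j₀) := by
        refine v.le_ord_sum_of_forall_le_ord A (fun i ↦ lam j₀ i • a i) _ (fun i hi hne0 ↦ ?_) hTj₀
        have hl : lam j₀ i ≠ 0 := by
          rintro h
          rw [h, zero_smul] at hne0
          exact hne0 rfl
        rw [v.ord_smul_of_ne_zero hl (ha0 i)]
        exact ciInf_le (Set.finite_range _).bddBelow (⟨i, hi⟩ : A)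
      have h2 : (⨅ x : Bj, v.ord (a x)) ≤ v.ord (T j₀) := by
        rw [← hBjsum]
        refine v.le_ord_sum_of_forall_le_ord Bj (fun i ↦ κ i • a i) _ (fun i hi _ ↦ ?_)
          (by rw [hBjsum]; exact hTj₀)
        rw [v.ord_smul_of_ne_zero (hκ0 i hi) (ha0 i)]
        exact ciInf_le (Set.finite_range _).bddBelow (⟨i, hi⟩ : Bj)
      have h3 : min (⨅ x : A, v.ord (a x)) (⨅ x : Bj, v.ord (a x)) ≤ ⨅ x : A', v.ord (a x) := by
        refine le_ciInf fun x ↦ ?_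
        rcases Finset.mem_union.1 x.2 with hxA | hxB'
        · exact (min_le_left _ _).trans (ciInf_le (Set.finite_range _).bddBelow (⟨x, hxA⟩ : A))
        · exact (min_le_right _ _).trans
            (ciInf_le (Set.finite_range _).bddBelow (⟨x, Finset.mem_insert_of_mem hxB'⟩ : Bj))
      rcases le_total (⨅ x : A, v.ord (a x)) (⨅ x : Bj, v.ord (a x)) with h | h
      · rw [min_eq_left h] at h3
        linarith
      · rw [min_eq_right h] at h3
        linarith
    have hchoose : (A.card.choose 2 : ℤ) + (Bj.card.choose 2 : ℤ) ≤ (A'.card.choose 2 : ℤ) := by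
      rw [hcardA', hBjcard']
      exact_mod_cast choose_two_add_choose_two_succ_le (Finset.card_pos.2 hAne) B'.card
    change ∑ v ∈ S, (v.ord b - ⨅ x : A', v.ord (a x)) ≤ (A'.card.choose 2 : ℤ) * X
    calc ∑ v ∈ S, (v.ord b - ⨅ x : A', v.ord (a x))
        ≤ ∑ v ∈ S, ((v.ord b - ⨅ x : A, v.ord (a x)) + (v.ord (T j₀) - ⨅ x : Bj, v.ord (a x))) :=
          Finset.sum_le_sum fun v _ ↦ hterm v
      _ = ∑ v ∈ S, (v.ord b - ⨅ x : A, v.ord (a x)) +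
            ∑ v ∈ S, (v.ord (T j₀) - ⨅ x : Bj, v.ord (a x)) := Finset.sum_add_distrib
      _ ≤ (A.card.choose 2 : ℤ) * X + (Bj.card.choose 2 : ℤ) * X := add_le_add hPA' key
      _ = ((A.card.choose 2 : ℤ) + (Bj.card.choose 2 : ℤ)) * X := by ring
      _ ≤ (A'.card.choose 2 : ℤ) * X := mul_le_mul_of_nonneg_right hchoose hX0
  /- iterate the step from `A₀` up to `B` ((ii): the sequence `μ_h` is increasing and bounded by `μ`) -/
  suffices hiter : ∀ (k : ℕ) (A : Finset ι), B.card - A.card = k → A₀ ⊆ A → A ⊆ B → P A → P B by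
    exact hiter _ A₀ rfl subset_rfl hA₀B hPA₀
  intro k
  induction k using Nat.strong_induction_on with
  | _ k ihk =>
  intro A hk hA₀A hAB hPA
  by_cases hAeqB : A = B
  · rw [hAeqB] at hPA
    exact hPA
  · obtain ⟨A', hAA', hA'B, hPA'⟩ := hstep A hA₀A hAB hAeqB hPA
    have hlt : B.card - A'.card < k := by
      have := Finset.card_lt_card hAA'
      have := Finset.card_le_card hA'B
      omega
    exact ihk _ hlt A' rfl (hA₀A.trans hAA'.subset) hA'B hPA'

end AlgFunctionField

/-! ## The discharges -/

/-- **Discharge of `Zannier1993_thm1`** (Zannier 1993, Theorem 1): `Zannier1993_thm1_rat` with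
`ι = Fin n` over an algebraically closed constant field of characteristic `0` (every place is rational,
`PlaceOver.isRational_of_isAlgClosed`, of degree `1`, and `k` is the full constant field,
`isIntegrallyClosedIn_of_isAlgClosed`). [cite: Zannier1993, Theorem 1] -/
theorem Zannier1993_thm1_holds : Zannier1993_thm1 := by
  intro k _ _ _ F _ _ _ S n a hn ha0 hS hΓ
  haveI := isIntegrallyClosedIn_of_isAlgClosed (K := k) (F := F)
  have hrat : ∀ P : PlaceOver k F, P.IsRational := PlaceOver.isRational_of_isAlgClosed
  have key := Zannier1993_thm1_rat hrat S n (Fintype.card_fin n) a ⟨⟨0, hn⟩⟩ ha0 hS hΓ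
  have hdeg : ∀ v : PlaceOver k F, (v.degree : ℤ) = 1 := fun v ↦ by exact_mod_cast hrat v
  simp_rw [hdeg, one_mul]
  exact key

/-- **Discharge of `Zannier1993_cor`** (Zannier 1993, Corollary p. 92): Theorem 1 and the printed
five-line reduction `Zannier1993_cor_of_thm1`. [cite: Zannier1993, Corollary p. 92] -/
theorem Zannier1993_cor_holds : Zannier1993_cor :=
  Zannier1993_cor_of_thm1 Zannier1993_thm1_holds

end Literature.NumberTheory.DiophantineGeometry
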